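import Summits.ValiantsHypothesis.ValiantsHypothesis.Theses.FermionizationDimension
import Summits.ValiantsHypothesis.ValiantsHypothesis.Theorems.FermionizationDimensionSDimPerNotQPLocalExpansion
import Summits.ValiantsHypothesis.ValiantsHypothesis.Theorems.FermionizationDimensionSDimPerNotQPGlobalExpansion
import Summits.ValiantsHypothesis.ValiantsHypothesis.Theorems.TwistedDetRankTdrSuperadditive

/-!
# Route FermionizationDimension — crux `SDimPerNotQP` (stmt-ValiantsHypothesis-7286):
# calibration — the expansion bounds with the NIL-INDEX in the exponent

Auxiliary registered stubs of the line `registered` of `Cruxes/SDimPerNotQP/Lines/birth.lean`,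
sharpening the landed calibration `(n+1)^d · d^d` (`stub_localExpansion`, `stub_globalExpansion`,
`stub_expansionBound`): the exponent is not the dimension `d` but the NIL-INDEX `N` of the
coefficient algebra (`(nilradical R)^N = 0`; for a local algebra, `𝔪^N = 0`, i.e. socle degree
`< N`):

* `stub_localExpansionNil` — local algebra `A` with character `χ` and `(ker χ)^N = 0`: every
  pattern `σ ↦ ℓ (∏ i, u (σ i) i)` is a scalar combination of `≤ (n+1)^N · D^N` transversal product
  patterns (`D = finrank ℂ A`);
* `stub_globalExpansionNil` — any finite-dimensional commutative `R` with `(nilradical R)^N = 0`: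
  `≤ (n+1)^N · d^N` (Chinese remainder theorem over the maximal ideals, `Σ_I d_I^N ≤ (Σ_I d_I)^N`);
* `stub_expansionBoundNil` — hence a commutative realisation of `sgn_n` of dimension `d` and
  nil-index `N` gives `per_n` as a sum of at most `(n+1)^N · d^N` Hadamard-twisted determinants:
  POLYNOMIAL in `d` for bounded nil-index. So the line's bet J_tr (semisimplification at
  quasi-polynomial cost) can only be carried by coefficient algebras whose nil-index grows faster
  than polylogarithmically — every truncated algebra `ℂ[η]/(deg > D)` of the route's cheap
  constructions (nil-index `D+1`) semisimplifies at polynomial cost.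

Proofs: verbatim the landed ones with the truncation threshold `finrank` replaced by `N`
(helpers `apply_prod_eq_sum`, `prod_eq_zero_of_le_card`, `card_subtype_le`, `exists_coordinates`
of Theorems/FermionizationDimensionSDimPerNotQPLocalExpansion.lean and `exists_localChar` of
Theorems/FermionizationDimensionSDimPerNotQPGlobalExpansion.lean are reused).

Sources: folklore.
-/

-- `Summit.<Summit>.<Problem>` repeats `ValiantsHypothesis` by the tree's layout convention (D-0017).
set_option linter.dupNamespace false

namespace Summit.ValiantsHypothesis.ValiantsHypothesis.Theorems

namespace FermionizationDimensionSDimPerNotQPExpansionNil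

open Finset

/-- For naturals and `N ≠ 0`: `Σ_(i ∈ s) x_i^N ≤ (Σ_(i ∈ s) x_i)^N`. [folklore] -/
theorem sum_pow_le_pow_sum' {ι : Type*} (s : Finset ι) (x : ι → ℕ) {N : ℕ} (hN : N ≠ 0) :
    ∑ i ∈ s, x i ^ N ≤ (∑ i ∈ s, x i) ^ N := by
  classical
  induction s using Finset.induction_on with
  | empty => simp
  | @insert a s ha ih =>
    rw [Finset.sum_insert ha, Finset.sum_insert ha]
    exact (Nat.add_le_add_left ih _).trans (pow_add_pow_le (Nat.zero_le _) (Nat.zero_le _) hN)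

/-- In the local factor `R ⧸ I^m` (`m ≠ 0`) of a finite-dimensional commutative `ℂ`-algebra, the
kernel of a suitable character `χ` satisfies `(ker χ)^m = 0`: `χ` = reduction modulo `I` followed
by the identification of the residue field with `ℂ`, so `ker χ = I / I^m`. [folklore] -/
theorem exists_localChar_ker_pow {R : Type} [CommRing R] [Algebra ℂ R] [Module.Finite ℂ R]
    (I : MaximalSpectrum R) {m : ℕ} (hm : m ≠ 0) :
    ∃ χ : (R ⧸ I.asIdeal ^ m) →ₐ[ℂ] ℂ, RingHom.ker χ ^ m = ⊥ := by
  obtain ⟨χ, hχ⟩ := FermionizationDimensionSDimPerNotQPGlobalExpansion.exists_localChar I hm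
  refine ⟨χ, ?_⟩
  -- `ker χ ≤ I.map mk`: an element of the kernel is `mk x` with `x - 0 • 1 ∈ I`... via nilpotence:
  -- `a ∈ ker χ` gives `a = a - algebraMap (χ a)` nilpotent, and nilpotents of `R ⧸ I^m` lie in `I / I^m`.
  have hle : RingHom.ker χ ≤ (I.asIdeal).map (Ideal.Quotient.mk (I.asIdeal ^ m)) := by
    intro a ha
    have hnil : IsNilpotent a := by
      have h := hχ a
      rwa [RingHom.mem_ker.1 ha, map_zero, sub_zero] at h
    obtain ⟨x, rfl⟩ := Ideal.Quotient.mk_surjective a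
    obtain ⟨k, hk⟩ := hnil
    rw [← map_pow, Ideal.Quotient.eq_zero_iff_mem] at hk
    have hxI : x ∈ I.asIdeal :=
      I.isMaximal.isPrime.mem_of_pow_mem k (Ideal.pow_le_self hm hk)
    exact Ideal.mem_map_of_mem _ hxI
  refine le_bot_iff.1 ?_
  calc RingHom.ker χ ^ m ≤ ((I.asIdeal).map (Ideal.Quotient.mk (I.asIdeal ^ m))) ^ m :=
        Ideal.pow_right_mono hle m
    _ = (I.asIdeal ^ m).map (Ideal.Quotient.mk (I.asIdeal ^ m)) := by rw [Ideal.map_pow]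
    _ = ⊥ := Ideal.map_quotient_self _
    _ ≤ ⊥ := le_rfl

end FermionizationDimensionSDimPerNotQPExpansionNil

open FermionizationDimensionSDimPerNotQPLocalExpansion in
/-- **Calibration L_N — local expansion bound with the nil-index** (auxiliary registered stub
`stub_localExpansionNil` of the line `registered` of crux `SDimPerNotQP`, stmt-ValiantsHypothesis-7286):
over a local finite-dimensional commutative `ℂ`-algebra `A` with character `χ` and `(ker χ)^N = 0`,
every pattern `σ ↦ ℓ (∏ i, u (σ i) i)` is a scalar combination of at most `(n+1)^N · D^N`
transversal product patterns, `D = finrank ℂ A`. [folklore] -/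
theorem stub_localExpansionNil :
    ∀ (n N : ℕ) (A : Type) [CommRing A] [Algebra ℂ A] [Module.Finite ℂ A] (χ : A →ₐ[ℂ] ℂ), RingHom.ker χ ^ N = ⊥ → ∀ (u : Fin n → Fin n → A) (ℓ : A →ₗ[ℂ] ℂ), ∃ (T : Type) (_ : Fintype T) (c : T → ℂ) (E : T → Fin n → Fin n → ℂ), Fintype.card T ≤ (n + 1) ^ N * Module.finrank ℂ A ^ N ∧ ∀ σ : Equiv.Perm (Fin n), ℓ (∏ i, u (σ i) i) = ∑ t, c t * ∏ i, E t (σ i) i := by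
  intro n N A _ _ _ χ hJ u ℓ
  obtain ⟨d, hd, w, e, -, hw, hdec⟩ := exists_coordinates χ
  refine ⟨{β : Fin n → Option (Fin d) // (Finset.univ.filter fun i => β i ≠ none).card < N},
    inferInstance, fun t => ℓ (∏ i, w (t.1 i)), fun t a i => e (t.1 i) (u a i), ?_, fun σ => ?_⟩
  · -- the count
    calc Fintype.card {β : Fin n → Option (Fin d) //
            (Finset.univ.filter fun i => β i ≠ none).card < N}
        ≤ (n + 1) ^ N * (d + 1) ^ N := card_subtype_le n d N
      _ = (n + 1) ^ N * Module.finrank ℂ A ^ N := by rw [hd]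
  · -- the representation: expand, then drop the vanishing long terms
    rw [apply_prod_eq_sum w e hdec (fun i => u (σ i) i) ℓ]
    have hvan : ∀ β : Fin n → Option (Fin d),
        ¬ (Finset.univ.filter fun i => β i ≠ none).card < N →
        ℓ (∏ i, w (β i)) * ∏ i, e (β i) (u (σ i) i) = 0 := fun β hβ => by
      rw [prod_eq_zero_of_le_card hJ w hw β (not_lt.1 hβ), map_zero, zero_mul]
    rw [← Finset.sum_filter_of_ne (s := Finset.univ)
      (p := fun β : Fin n → Option (Fin d) =>
        (Finset.univ.filter fun i => β i ≠ none).card < N)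
      (fun β _ hne => not_not.1 fun h => hne (hvan β h))]
    exact Finset.sum_subtype _ (fun β => by simp) _

open FermionizationDimensionSDimPerNotQPExpansionNil in
/-- **Calibration G_N — global expansion bound with the nil-index** (auxiliary registered stub
`stub_globalExpansionNil` of the line `registered` of crux `SDimPerNotQP`, stmt-ValiantsHypothesis-7286):
over any finite-dimensional commutative `ℂ`-algebra `R` with `(nilradical R)^N = 0`, every pattern
`σ ↦ ℓ (∏ i, u (σ i) i)` is a scalar combination of at most `(n+1)^N · d^N` transversal product
patterns, `d = finrank ℂ R` (CRT `R ≅ Π_I R ⧸ I^N`, `stub_localExpansionNil` on each factor,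
`Σ_I d_I^N ≤ d^N`). [folklore] -/
theorem stub_globalExpansionNil :
    ∀ (n N : ℕ) (R : Type) [CommRing R] [Algebra ℂ R] [Module.Finite ℂ R], nilradical R ^ N = ⊥ → ∀ (u : Fin n → Fin n → R) (ℓ : R →ₗ[ℂ] ℂ), ∃ (T : Type) (_ : Fintype T) (c : T → ℂ) (E : T → Fin n → Fin n → ℂ), Fintype.card T ≤ (n + 1) ^ N * Module.finrank ℂ R ^ N ∧ ∀ σ : Equiv.Perm (Fin n), ℓ (∏ i, u (σ i) i) = ∑ t, c t * ∏ i, E t (σ i) i := by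
  intro n N R _ _ _ hN u ℓ
  classical
  rcases Nat.eq_zero_or_pos N with rfl | hNpos
  · -- `N = 0`: `⊤ = ⊥`, `R` is trivial, the pattern is zero: take `T` empty
    have htriv : (⊤ : Ideal R) = ⊥ := by simpa using hN
    have h1 : (1 : R) = 0 := by
      have h : (1 : R) ∈ (⊥ : Ideal R) := htriv ▸ Submodule.mem_top
      exact Ideal.mem_bot.1 h
    have hR : ∀ x : R, x = 0 := fun x => by rw [← mul_one x, h1, mul_zero]
    refine ⟨PEmpty, inferInstance, PEmpty.elim, PEmpty.elim, by simp, fun σ => ?_⟩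
    rw [hR (∏ i, u (σ i) i), map_zero]
    simp
  haveI : IsArtinianRing R := IsArtinianRing.of_finite ℂ R
  letI : Fintype (MaximalSpectrum R) := Fintype.ofFinite _
  have hm : N ≠ 0 := hNpos.ne'
  -- the CRT decomposition into local factors of nil-index `≤ N`
  let e : R ≃ₐ[ℂ] (∀ I : MaximalSpectrum R, R ⧸ I.asIdeal ^ N) :=
    (((AlgEquiv.quotientBot R R).symm.trans (Ideal.quotientEquivAlgOfEq R hN.symm)).trans
      (IsArtinianRing.quotNilradicalPowEquivPi R N)).restrictScalars ℂ
  let uI : ∀ I : MaximalSpectrum R, Fin n → Fin n → R ⧸ I.asIdeal ^ N := fun I a b => e (u a b) I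
  let ℓI : ∀ I : MaximalSpectrum R, (R ⧸ I.asIdeal ^ N) →ₗ[ℂ] ℂ :=
    fun I => ℓ ∘ₗ e.symm.toLinearMap ∘ₗ
      LinearMap.single ℂ (fun J : MaximalSpectrum R => R ⧸ J.asIdeal ^ N) I
  have hsplit : ∀ σ : Equiv.Perm (Fin n),
      ℓ (∏ i, u (σ i) i) = ∑ I, ℓI I (∏ i, uI I (σ i) i) := by
    intro σ
    have hx : (∏ i, u (σ i) i) = e.symm (∑ I, Pi.single I (e (∏ i, u (σ i) i) I)) := by
      rw [Finset.univ_sum_single, AlgEquiv.symm_apply_apply]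
    rw [hx, map_sum, map_sum]
    refine Finset.sum_congr rfl fun I _ => ?_
    simp only [ℓI, uI, LinearMap.coe_comp, Function.comp_apply, LinearMap.coe_single,
      AlgEquiv.toLinearMap_apply, map_prod, Finset.prod_apply]
  choose χ hχ using fun I : MaximalSpectrum R => exists_localChar_ker_pow I hm
  have hloc := fun I : MaximalSpectrum R =>
    stub_localExpansionNil n N (R ⧸ I.asIdeal ^ N) (χ I) (hχ I) (uI I) (ℓI I)
  choose T instT c E hcard hrep using hloc
  letI : ∀ I, Fintype (T I) := instT
  refine ⟨(Σ I : MaximalSpectrum R, T I), inferInstance, fun p => c p.1 p.2, fun p => E p.1 p.2,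
    ?_, fun σ => ?_⟩
  · -- the count: `Σ_I (n+1)^N d_I^N ≤ (n+1)^N (Σ_I d_I)^N = (n+1)^N d^N`
    have hdI_sum : ∑ I : MaximalSpectrum R, Module.finrank ℂ (R ⧸ I.asIdeal ^ N) =
        Module.finrank ℂ R := by
      rw [e.toLinearEquiv.finrank_eq, Module.finrank_pi_fintype]
    rw [Fintype.card_sigma]
    calc ∑ I, Fintype.card (T I)
        ≤ ∑ I : MaximalSpectrum R, (n + 1) ^ N * Module.finrank ℂ (R ⧸ I.asIdeal ^ N) ^ N :=
          Finset.sum_le_sum fun I _ => hcard I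
      _ = (n + 1) ^ N * ∑ I : MaximalSpectrum R, Module.finrank ℂ (R ⧸ I.asIdeal ^ N) ^ N := by
          rw [Finset.mul_sum]
      _ ≤ (n + 1) ^ N * (∑ I : MaximalSpectrum R, Module.finrank ℂ (R ⧸ I.asIdeal ^ N)) ^ N :=
          Nat.mul_le_mul_left _ (sum_pow_le_pow_sum' _ _ hm)
      _ = (n + 1) ^ N * Module.finrank ℂ R ^ N := by rw [hdI_sum]
  · rw [hsplit σ, Fintype.sum_sigma]
    exact Finset.sum_congr rfl fun I _ => hrep I σ

open TwistedDetRankTdrSuperadditive in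
/-- **Calibration E_N — expansion bound on `tdr` with the nil-index** (auxiliary registered stub
`stub_expansionBoundNil` of the line `registered` of crux `SDimPerNotQP`, stmt-ValiantsHypothesis-7286):
a commutative realisation of `sgn_n` of dimension `d` whose nilradical satisfies
`(nilradical R)^N = 0` gives `per_n` as a sum of at most `(n+1)^N · d^N` Hadamard-twisted
determinants — polynomial in `d` for bounded nil-index. [folklore; MarcusMinc1961] -/
theorem stub_expansionBoundNil :
    ∀ (n N : ℕ) (R : Type) [CommRing R] [Algebra ℂ R] [Module.Finite ℂ R] (u : Fin n → Fin n → R) (ℓ : R →ₗ[ℂ] ℂ), (∀ σ : Equiv.Perm (Fin n), ℓ (∏ i, u (σ i) i) = ((Equiv.Perm.sign σ : ℤ) : ℂ)) → nilradical R ^ N = ⊥ → ∃ r ≤ (n + 1) ^ N * Module.finrank ℂ R ^ N, ∃ E : Fin r → Matrix (Fin n) (Fin n) ℂ, Literature.Computability.AlgebraicComplexity.perPoly (Fin n) ℂ = ∑ t, (Matrix.of fun i j => MvPolynomial.C (E t i j) * MvPolynomial.X (i, j)).det := by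
  intro n N R _ _ _ u ℓ hu hN
  classical
  -- `R` is nontrivial, so `d ≥ 1`, `N ≥ 1` and the bound is `≥ 1`
  have hd : 0 < Module.finrank ℂ R := by
    rcases Nat.eq_zero_or_pos (Module.finrank ℂ R) with h0 | hpos
    · exfalso
      have hR : ∀ x : R, x = 0 := finrank_zero_iff_forall_zero.1 h0
      have h1 := hu 1
      rw [hR (∏ i, u ((1 : Equiv.Perm (Fin n)) i) i), map_zero] at h1
      simp at h1
    · exact hpos
  have hbound : 1 ≤ (n + 1) ^ N * Module.finrank ℂ R ^ N :=
    Nat.one_le_iff_ne_zero.2 (Nat.mul_ne_zero (pow_ne_zero _ (Nat.succ_ne_zero n))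
      (pow_ne_zero _ hd.ne'))
  obtain ⟨T, _, c, E, hcard, hrep⟩ := stub_globalExpansionNil n N R hN u ℓ
  set r := Fintype.card T with hr
  let e : T ≃ Fin r := Fintype.equivFin T
  have hpat : ∀ σ : Equiv.Perm (Fin n),
      ((Equiv.Perm.sign σ : ℤ) : ℂ) = ∑ t : Fin r, c (e.symm t) * ∏ i, E (e.symm t) (σ i) i := by
    intro σ
    rw [← hu σ, hrep σ]
    exact (Equiv.sum_comp e.symm (fun t => c t * ∏ i, E t (σ i) i)).symm
  rcases Nat.eq_zero_or_pos n with rfl | hn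
  · exact ⟨1, hbound, fun _ => 0, perPoly_fin_zero_eq_sum_one _⟩
  · obtain ⟨F, hF⟩ := exists_rep_of_smul_rep hn _ (fun t => c (e.symm t))
      (fun t i j => E (e.symm t) i j) hpat
    exact ⟨r, hcard, F, (perPoly_eq_sum_twistedDet_iff F).2 hF⟩

end Summit.ValiantsHypothesis.ValiantsHypothesis.Theorems
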